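import Summits.BirchSwinnertonDyer.BirchSwinnertonDyer.Theorems.EisensteinPrimesFullDescentKummerArithmetic
import Summits.BirchSwinnertonDyer.BirchSwinnertonDyer.Theorems.EisensteinPrimesFullDescentKummerModule
import Literature.NumberTheory.GaloisRepresentations.GaloisCohomologyKummerCocycles
import Literature.NumberTheory.EllipticCurves.OpenImageMazurCharacterProofs
import HarnessLib

/-!
# Route `EisensteinPrimes`, crux 2 `GoodLatticeBDPValue` (stmt-BirchSwinnertonDyer-19032), line `halves`, AN-3 Stub B
# (`FullDescentAtThreeOfRed`), global input F5: **the Kummer splitting lemma** — an extension `0 → 𝟙 → X → μ₃ → 0` of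
# `Γ_ℚ`-modules that is inertia-trivial at every prime `≠ 3` and split at the decomposition group of `3` SPLITS (KERNEL;
# no class field theory of `ℚ(ζ₃)`, no named fact)

Cell `bsd-eis` (home `run/shared/lean/pub/bsd-eis/`), width seat `bsd-line-x1-p1-w2` (gen 5; `--supports -19032`, closes
nothing by itself). Stub F5 of the AN-3 road memo `HOME/line-x1-p1-w3-g4/AN3-StubB-elementary-road.md` (w3 gen 4, §4; there
via (G-K) = `h(ℚ(ζ₃)) = 1`, here WITHOUT it), used twice in the elementary `E[9]` proof of Theorem T′ (idea-11 g9
`Cruxes/GoodLatticeBDPValue/Lines/halves_anThree_typedSplit_idea11g9.lean` §3): for `X = E[3] ⊇ Φ = 𝟙` (Case 𝟙, B3) and for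
`X = 3⁻¹C/C ⊇ E[3]/C` (Case ω, A2). RELATIVE FORMULATION (no quotient types): `L ≤ N ≤ M` subgroups of a `Γ_ℚ`-module `V`
with `#N = 3·#L`, `#M = 9·#L`, `3M ≤ L`, `L` stable, `Γ_ℚ` trivial on `N/L` and acting through the mod `3` cyclotomic
character `χ̄₃` on `M/N`; HYPOTHESES: stabilisers open, one inertia group above every `v ∤ 3` trivial on `M/L`, and a
`D₃`-stable `B₃` with `L ≤ B₃ ≤ M`, `#B₃ = 3·#L`, `B₃ ⊓ N = L`; CONCLUSION: a `Γ_ℚ`-stable `B` with `L ≤ B ≤ M`, `B ⊓ N = L`,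
`N ⊔ B = M`. PROOF: with `a₀ ∈ N ∖ L`, `b₀ ∈ B₃ ∖ L`, `σ b₀ ≡ e_σ b₀ + n_σ a₀ (mod L)` (`e_σ = χ̄₃(σ) ∈ {1, 2}`); the map
`c(σ) = ζ^{e_σ n_σ}` (`ζ` a primitive cube root of unity in `ℚ̄`) is a locally constant `μ₃`-valued 1-cocycle of `Γ_ℚ`, hence
(cocycle-level Kummer theory over `ℚ`, the tree's `absoluteGaloisGroup.exists_kummer_eq_of_isLocallyConstant_cocycle` — NO
`μ₃ ⊆ ℚ` needed) `c(σ) = σα/α` with `α³ = a ∈ ℚˣ`; inertia-triviality away from `3` and `D₃`-stability of `B₃` give `n_τ ≡ 0`,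
i.e. `I_𝔓` and `D₃` fix `α`, so `a ∈ ℚ׳` (`FullDescentKummerArithmetic.exists_pow_three_eq_of_forall_inertia_of_decomp`), `α = rζ^j`,
`n_σ ≡ j(1 − e_σ)`, and `b₁ = b₀ − j a₀` spans the complement.

* **`exists_stable_complement`** — the splitting lemma (module-theoretic preliminaries in the sibling
  `…FullDescentKummerModule`, arithmetic in `…FullDescentKummerArithmetic`).

HONEST FRAMING: helper theorems only (0 definitions, 0 named facts, 0 sorry); no summit statement, no BSD / IMC2 /
Keller–Yin theorem, no stub of the registered skeleton is proved here. References: [SilvermanAEC2009] VIII §1–2 (Kummer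
theory, unramified classes), X §4; [SerreLocalFields1979] Ch. X §3 b); [Serre1972] §1.3.
-/

set_option autoImplicit false
-- the route's Theorems namespace repeats the summit name by design (D-0017 nested layout)
set_option linter.dupNamespace false

noncomputable section

open scoped Classical NumberField

namespace Summit.BirchSwinnertonDyer.BirchSwinnertonDyer.Theorems.FullDescentKummerSplitting

open Function NumberField IsDedekindDomain Field Rat.HeightOneSpectrum
  Literature.NumberTheory.GaloisRepresentations Literature.NumberTheory.EllipticCurves
  Summit.BirchSwinnertonDyer.BirchSwinnertonDyer.Theorems.FullDescentKummerArithmetic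
  Summit.BirchSwinnertonDyer.BirchSwinnertonDyer.Theorems.FullDescentKummerModule

/-! ## The splitting lemma -/

/-- **The Kummer splitting lemma for `0 → 𝟙 → X → μ₃ → 0` over `Γ_ℚ`** (relative form, see the module docstring).
`V` a `Γ_ℚ`-module, `L ≤ N ≤ M ≤ V` with `#L = c ≠ 0`, `#N = 3c`, `#M = 9c`, `3M ≤ L`, `L` stable, `Γ_ℚ` trivial on
`N/L` and `≡ χ̄₃` on `M/N`, stabilisers of the elements of `M` open; if for every finite place `v ∤ 3` SOME inertia group
above `v` is trivial on `M/L`, and at the place `v₃ ∣ 3` some `B₃` with `L ≤ B₃ ≤ M`, `#B₃ = 3c`, `B₃ ⊓ N = L` is stable under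
the decomposition group `GreenbergSelmer.decomp v₃`, then there is a `Γ_ℚ`-STABLE `B` with `L ≤ B ≤ M`, `B ⊓ N = L`,
`N ⊔ B = M`. [cite: SilvermanAEC2009, VIII §2 and X §4 (unramified Kummer classes)] [cite: SerreLocalFields1979, Ch. X §3 b)] -/
theorem exists_stable_complement {V : Type*} [AddCommGroup V] [DistribMulAction (absoluteGaloisGroup ℚ) V]
    (L N M : AddSubgroup V) (hLN : L ≤ N) (hNM : N ≤ M) {c : ℕ} (hc : c ≠ 0)
    (hcL : Nat.card L = c) (hcN : Nat.card N = 3 * c) (hcM : Nat.card M = 9 * c)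
    (hL : ∀ (σ : absoluteGaloisGroup ℚ), ∀ x ∈ L, σ • x ∈ L)
    (h3 : ∀ x ∈ M, (3 : ℤ) • x ∈ L)
    (hA : ∀ (σ : absoluteGaloisGroup ℚ), ∀ x ∈ N, σ • x - x ∈ L)
    (hω : ∀ (σ : absoluteGaloisGroup ℚ), ∀ x ∈ M,
      σ • x - (((modNCyclotomicCharacter ℚ 3 σ : (ZMod 3)ˣ) : ZMod 3).val : ℤ) • x ∈ N)
    (hcont : ∀ x ∈ M, IsOpen ((MulAction.stabilizer (absoluteGaloisGroup ℚ) x : Subgroup (absoluteGaloisGroup ℚ)) :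
      Set (absoluteGaloisGroup ℚ)))
    (hunr : ∀ v : HeightOneSpectrum (𝓞 ℚ), natGenerator v ≠ 3 →
      ∃ 𝔓 ∈ v.primesAbove, ∀ τ ∈ 𝔓.inertia (absoluteGaloisGroup ℚ), ∀ x ∈ M, τ • x - x ∈ L)
    {v₃ : HeightOneSpectrum (𝓞 ℚ)} (hv₃ : natGenerator v₃ = 3)
    (hspl : ∃ B₃ : AddSubgroup V, L ≤ B₃ ∧ B₃ ≤ M ∧ Nat.card B₃ = 3 * c ∧ B₃ ⊓ N = L ∧
      ∀ δ ∈ GreenbergSelmer.decomp (K := ℚ) v₃, ∀ x ∈ B₃, δ • x ∈ B₃) :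
    ∃ B : AddSubgroup V, L ≤ B ∧ B ≤ M ∧ B ⊓ N = L ∧ N ⊔ B = M ∧
      ∀ (σ : absoluteGaloisGroup ℚ), ∀ x ∈ B, σ • x ∈ B := by
  -- ### notation: the character exponent `e σ ∈ {1, 2}`
  set χ : absoluteGaloisGroup ℚ →* (ZMod 3)ˣ := modNCyclotomicCharacter ℚ 3 with hχ
  set e : absoluteGaloisGroup ℚ → ℤ := fun σ ↦ (((χ σ : (ZMod 3)ˣ) : ZMod 3).val : ℤ) with he
  have he12 : ∀ σ, e σ = 1 ∨ e σ = 2 := fun σ ↦ by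
    rcases val_modNCyclotomicCharacter_three σ with h | h
    · left; simp only [he, hχ, h, Nat.cast_one]
    · right; simp only [he, hχ, h, Nat.cast_ofNat]
  have hesq : ∀ σ, e σ * e σ ≡ 1 [ZMOD 3] := fun σ ↦ by
    rcases he12 σ with h | h <;> rw [h] <;> decide
  have hmod3 : ∀ A : ℤ, A % 3 ≡ A [ZMOD 3] := fun A ↦ Int.mod_modEq A 3
  have hemul : ∀ σ τ, e (σ * τ) ≡ e σ * e τ [ZMOD 3] := by
    intro σ τ
    have h1 : ((χ (σ * τ) : (ZMod 3)ˣ) : ZMod 3).val =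
        (((χ σ : (ZMod 3)ˣ) : ZMod 3).val * ((χ τ : (ZMod 3)ˣ) : ZMod 3).val) % 3 := by
      rw [map_mul, Units.val_mul, ZMod.val_mul]
    simp only [he]
    rw [h1, Int.natCast_mod, Nat.cast_mul, Nat.cast_ofNat]
    exact hmod3 _
  -- `σ` commutes with integer multiples
  have hσz : ∀ (σ : absoluteGaloisGroup ℚ) (k : ℤ) (x : V), σ • (k • x) = k • (σ • x) := fun σ k x ↦
    map_zsmul (DistribSMul.toAddMonoidHom V σ) k x
  -- ### the two generators `a₀ ∈ N ∖ L`, `b₀ ∈ B₃ ∖ L`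
  obtain ⟨a₀, ha₀N, ha₀L⟩ := exists_mem_not_mem_of_card hLN hc hcL hcN
  have ha₀M : a₀ ∈ M := hNM ha₀N
  obtain ⟨B₃, hLB₃, hB₃M, hcB₃, hB₃N, hB₃stab⟩ := hspl
  obtain ⟨b₀, hb₀B₃, hb₀L⟩ := exists_mem_not_mem_of_card hLB₃ hc hcL hcB₃
  have hb₀M : b₀ ∈ M := hB₃M hb₀B₃
  have hb₀N : b₀ ∉ N := fun h ↦ hb₀L (by rw [← hB₃N]; exact ⟨hb₀B₃, h⟩)
  have h3c : 3 * c ≠ 0 := by omega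
  have genN : ∀ y ∈ N, ∃ k : ℤ, y - k • a₀ ∈ L := exists_zsmul_sub_mem_of_card hLN hc hcL hcN ha₀N ha₀L
  have genM : ∀ x ∈ M, ∃ j : ℤ, x - j • b₀ ∈ N :=
    exists_zsmul_sub_mem_of_card hNM h3c hcN (by rw [hcM]; ring) hb₀M hb₀N
  have genB : ∀ y ∈ B₃, ∃ m : ℤ, y - m • b₀ ∈ L := exists_zsmul_sub_mem_of_card hLB₃ hc hcL hcB₃ hb₀B₃ hb₀L
  have h3b₀ : (3 : ℤ) • b₀ ∈ L := h3 b₀ hb₀M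
  have h3a₀ : (3 : ℤ) • a₀ ∈ L := h3 a₀ ha₀M
  -- multiples by a multiple of `3` land in `L`
  have hLmul : ∀ {x : V} {k : ℤ}, (3 : ℤ) • x ∈ L → (3 : ℤ) ∣ k → k • x ∈ L := by
    rintro x k hx ⟨k', rfl⟩
    rw [mul_comm, mul_smul]
    exact L.zsmul_mem hx k'
  -- ### uniqueness of coordinates modulo `L`
  have U : ∀ i j : ℤ, i • a₀ + j • b₀ ∈ L → (3 : ℤ) ∣ i ∧ (3 : ℤ) ∣ j := by
    intro i j hij
    have hjN : j • b₀ ∈ N := by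
      have : j • b₀ = (i • a₀ + j • b₀) - i • a₀ := by abel
      rw [this]
      exact N.sub_mem (hLN hij) (N.zsmul_mem ha₀N i)
    have hj : (3 : ℤ) ∣ j := three_dvd_of_zsmul_mem (hLN h3b₀) hb₀N hjN
    have hiL : i • a₀ ∈ L := by
      have : i • a₀ = (i • a₀ + j • b₀) - j • b₀ := by abel
      rw [this]
      exact L.sub_mem hij (hLmul h3b₀ hj)
    exact ⟨three_dvd_of_zsmul_mem h3a₀ ha₀L hiL, hj⟩
  -- ### the coefficient `n σ`: `σ b₀ ≡ e σ • b₀ + n σ • a₀ (mod L)`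
  have hn' : ∀ σ : absoluteGaloisGroup ℚ, ∃ k : ℤ, (σ • b₀ - e σ • b₀) - k • a₀ ∈ L := fun σ ↦
    genN _ (hω σ b₀ hb₀M)
  choose n hn using hn'
  have hdecomp : ∀ σ : absoluteGaloisGroup ℚ, ∃ ℓ ∈ L, σ • b₀ = e σ • b₀ + n σ • a₀ + ℓ := fun σ ↦
    ⟨σ • b₀ - e σ • b₀ - n σ • a₀, hn σ, by abel⟩
  have hA' : ∀ σ : absoluteGaloisGroup ℚ, ∃ ℓ ∈ L, σ • a₀ = a₀ + ℓ := fun σ ↦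
    ⟨σ • a₀ - a₀, hA σ a₀ ha₀N, by abel⟩
  -- ### the cocycle relation `n (σ τ) ≡ e τ n σ + n τ (mod 3)`
  have hcocycle : ∀ σ τ, n (σ * τ) ≡ e τ * n σ + n τ [ZMOD 3] := by
    intro σ τ
    obtain ⟨y, hy, hτ⟩ := hdecomp τ
    obtain ⟨y₁, hy₁, hσ⟩ := hdecomp σ
    obtain ⟨y₂, hy₂, hσa⟩ := hA' σ
    obtain ⟨y₃, hy₃, hστ⟩ := hdecomp (σ * τ)
    have h1 : (σ * τ) • b₀ = (e τ * e σ) • b₀ + (e τ * n σ + n τ) • a₀ + (e τ • y₁ + n τ • y₂ + σ • y) := by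
      rw [mul_smul, hτ, smul_add, smul_add, hσz, hσz, hσ, hσa]
      simp only [smul_add, mul_smul, add_smul]
      abel
    have hmem : (n (σ * τ) - (e τ * n σ + n τ)) • a₀ + (e (σ * τ) - e τ * e σ) • b₀ ∈ L := by
      have : (n (σ * τ) - (e τ * n σ + n τ)) • a₀ + (e (σ * τ) - e τ * e σ) • b₀ =
          (e (σ * τ) • b₀ + n (σ * τ) • a₀ + y₃) - ((e τ * e σ) • b₀ + (e τ * n σ + n τ) • a₀ +
            (e τ • y₁ + n τ • y₂ + σ • y)) + ((e τ • y₁ + n τ • y₂ + σ • y) - y₃) := by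
        simp only [sub_smul]
        abel
      rw [this, ← hστ, ← h1, sub_self, zero_add]
      exact L.sub_mem (L.add_mem (L.add_mem (L.zsmul_mem hy₁ _) (L.zsmul_mem hy₂ _)) (hL σ y hy)) hy₃
    exact (Int.modEq_iff_dvd.mpr (U _ _ hmem).1).symm
  -- ### a primitive cube root of unity and the cocycle `c σ = ζ ^ (e σ * n σ)`
  obtain ⟨ζ, hζ⟩ := HasEnoughRootsOfUnity.exists_primitiveRoot (AlgebraicClosure ℚ) 3
  have hζ0 : ζ ≠ 0 := hζ.ne_zero (by norm_num)
  set ζu : (AlgebraicClosure ℚ)ˣ := Units.mk0 ζ hζ0 with hζudef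
  have hζu : IsPrimitiveRoot ζu 3 := by
    rw [← IsPrimitiveRoot.coe_units_iff]; exact hζ
  have hζpow : ∀ z z' : ℤ, z ≡ z' [ZMOD 3] → ζu ^ z = ζu ^ z' := by
    intro z z' hzz
    rw [← mul_inv_eq_one, ← zpow_neg, ← zpow_add, ← sub_eq_add_neg, hζu.zpow_eq_one_iff_dvd]
    exact_mod_cast hzz.symm.dvd
  -- the Galois action on `ζ`
  have hσζ : ∀ σ : absoluteGaloisGroup ℚ, σ • ζu = ζu ^ (e σ) := by
    intro σ
    ext
    rw [Units.coe_smul, hζudef, Units.val_mk0, zpow_natCast, Units.val_pow_eq_pow_val, Units.val_mk0]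
    exact modNCyclotomicCharacter_spec ℚ 3 σ ζ hζ.pow_eq_one
  set cc : absoluteGaloisGroup ℚ → (AlgebraicClosure ℚ)ˣ := fun σ ↦ ζu ^ (e σ * n σ) with hcc
  have hccval : ∀ σ, (cc σ : AlgebraicClosure ℚ) = ζ ^ (e σ * n σ) := fun σ ↦ by
    simp only [hcc, hζudef, Units.val_zpow_eq_zpow_val, Units.val_mk0]
  -- (C1) values in `μ₃`
  have hc3 : ∀ σ, cc σ ^ 3 = 1 := fun σ ↦ by
    simp only [hcc]
    rw [← zpow_natCast, ← zpow_mul, mul_comm, zpow_mul, zpow_natCast, hζu.pow_eq_one, one_zpow]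
  -- (C2) the cocycle identity
  have hcoc : ∀ σ τ, cc (σ * τ) = cc σ * σ • cc τ := by
    intro σ τ
    simp only [hcc]
    rw [smul_zpow', hσζ, ← zpow_mul, ← zpow_add]
    apply hζpow
    calc e (σ * τ) * n (σ * τ) ≡ (e σ * e τ) * (e τ * n σ + n τ) [ZMOD 3] := (hemul σ τ).mul (hcocycle σ τ)
      _ = e σ * n σ * (e τ * e τ) + e σ * (e τ * n τ) := by ring
      _ ≡ e σ * n σ * 1 + e σ * (e τ * n τ) [ZMOD 3] := ((hesq τ).mul_left _).add_right _
      _ = e σ * n σ + e σ * (e τ * n τ) := by ring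
  -- (C3) local constancy
  have hnwd : ∀ σ σ' : absoluteGaloisGroup ℚ, σ • b₀ = σ' • b₀ → e σ = e σ' → n σ ≡ n σ' [ZMOD 3] := by
    intro σ σ' hb he'
    have h1 := L.sub_mem (hn σ') (hn σ)
    rw [hb, he'] at h1
    have : (σ' • b₀ - e σ' • b₀ - n σ' • a₀) - (σ' • b₀ - e σ' • b₀ - n σ • a₀) =
        (n σ - n σ') • a₀ + (0 : ℤ) • b₀ := by
      rw [sub_smul, zero_smul]; abel
    rw [this] at h1
    exact (Int.modEq_iff_dvd.mpr (U _ _ h1).1).symm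
  have hlc : IsLocallyConstant cc := by
    rw [IsLocallyConstant.iff_exists_open]
    intro σ₀
    refine ⟨{σ | σ • b₀ = σ₀ • b₀} ∩ {σ | χ σ = χ σ₀}, ?_, ⟨rfl, rfl⟩, ?_⟩
    · apply IsOpen.inter
      · have h1 : {σ : absoluteGaloisGroup ℚ | σ • b₀ = σ₀ • b₀} =
            (fun σ ↦ σ₀⁻¹ * σ) ⁻¹' (MulAction.stabilizer (absoluteGaloisGroup ℚ) b₀ : Set (absoluteGaloisGroup ℚ)) := by
          ext σ
          simp only [Set.mem_setOf_eq, Set.mem_preimage, SetLike.mem_coe, MulAction.mem_stabilizer_iff, mul_smul,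
            inv_smul_eq_iff]
        rw [h1]
        exact (hcont b₀ hb₀M).preimage (continuous_const_mul σ₀⁻¹)
      · have h1 : {σ : absoluteGaloisGroup ℚ | χ σ = χ σ₀} =
            (fun σ ↦ σ₀⁻¹ * σ) ⁻¹' (χ.ker : Set (absoluteGaloisGroup ℚ)) := by
          ext σ
          rw [Set.mem_setOf_eq, Set.mem_preimage, SetLike.mem_coe, MonoidHom.mem_ker, map_mul, map_inv, inv_mul_eq_one]
          exact eq_comm
        rw [h1]
        exact (Mazur1978.isOpen_ker_modNCyclotomicCharacter 3).preimage (continuous_const_mul σ₀⁻¹)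
    · rintro σ ⟨hσb, hσχ⟩
      have hσχ' : χ σ = χ σ₀ := hσχ
      have heq : e σ = e σ₀ := by simp only [he, hσχ']
      simp only [hcc]
      apply hζpow
      rw [heq]
      exact (hnwd σ σ₀ hσb heq).mul_left _
  -- (C4) Kummer theory over `ℚ`: `c σ = σ α / α`, `α³ = a ∈ ℚˣ`
  obtain ⟨a, α, hα3, hcα⟩ := absoluteGaloisGroup.exists_kummer_eq_of_isLocallyConstant_cocycle ℚ 3 hlc hc3 hcoc
  have hα3' : (α : AlgebraicClosure ℚ) ^ 3 = ((a : ℚ) : AlgebraicClosure ℚ) := by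
    have := congrArg Units.val hα3
    rw [Units.val_pow_eq_pow_val, Units.coe_map, MonoidHom.coe_coe, eq_ratCast] at this
    exact this
  have ha0 : (a : ℚ) ≠ 0 := a.ne_zero
  -- `n σ ≡ 0 ⟹ σ` fixes `α`
  have hfix : ∀ σ : absoluteGaloisGroup ℚ, n σ ≡ 0 [ZMOD 3] → σ • (α : AlgebraicClosure ℚ) = α := by
    intro σ hσ
    have h1 : cc σ = 1 := by
      have h2 : ζu ^ (e σ * n σ) = ζu ^ (e σ * 0) := hζpow _ _ (hσ.mul_left _)
      simp only [hcc]
      rw [h2, mul_zero, zpow_zero]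
    rw [hcα σ, div_eq_one] at h1
    have h2 := congrArg Units.val h1
    rwa [Units.coe_smul] at h2
  -- ### local analysis: inertia away from `3` and `D₃` fix `α`
  have hIfix : ∀ v : HeightOneSpectrum (𝓞 ℚ), natGenerator v ≠ 3 →
      ∃ 𝔓 ∈ v.primesAbove, ∀ τ ∈ 𝔓.inertia (absoluteGaloisGroup ℚ), τ • (α : AlgebraicClosure ℚ) = α := by
    intro v hv
    obtain ⟨𝔓, h𝔓, hI⟩ := hunr v hv
    refine ⟨𝔓, h𝔓, fun τ hτ ↦ hfix τ ?_⟩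
    have h1 := L.sub_mem (hI τ hτ b₀ hb₀M) (hn τ)
    have : (τ • b₀ - b₀) - (τ • b₀ - e τ • b₀ - n τ • a₀) = n τ • a₀ + (e τ - 1) • b₀ := by
      rw [sub_smul, one_smul]; abel
    rw [this] at h1
    exact (Int.modEq_iff_dvd.mpr (by rw [sub_zero]; exact (U _ _ h1).1)).symm
  have hDfix : ∀ δ ∈ GreenbergSelmer.decomp (K := ℚ) v₃, δ • (α : AlgebraicClosure ℚ) = α := by
    intro δ hδ
    apply hfix
    obtain ⟨m, hm⟩ := genB _ (hB₃stab δ hδ b₀ hb₀B₃)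
    have h1 := L.sub_mem hm (hn δ)
    have : (δ • b₀ - m • b₀) - (δ • b₀ - e δ • b₀ - n δ • a₀) = n δ • a₀ + (e δ - m) • b₀ := by
      rw [sub_smul]; abel
    rw [this] at h1
    exact (Int.modEq_iff_dvd.mpr (by rw [sub_zero]; exact (U _ _ h1).1)).symm
  -- ### so `a` is a rational cube and `α = r ζ^j`
  obtain ⟨r, hr⟩ := exists_pow_three_eq_of_forall_inertia_of_decomp ha0 hα3' hIfix hv₃ hDfix
  have hr0 : ((r : ℚ) : AlgebraicClosure ℚ) ≠ 0 := by
    intro h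
    rw [Rat.cast_eq_zero] at h
    rw [h, zero_pow (by norm_num)] at hr
    exact ha0 hr.symm
  have hquot : ((α : AlgebraicClosure ℚ) / r) ^ 3 = 1 := by
    rw [div_pow, hα3', ← hr, Rat.cast_pow, div_self (pow_ne_zero _ hr0)]
  obtain ⟨j, -, hj⟩ := hζ.eq_pow_of_pow_eq_one hquot
  have hαr : (α : AlgebraicClosure ℚ) = r * ζ ^ j := by
    rw [hj, mul_div_cancel₀ _ hr0]
  -- `c σ = ζ^{j(e σ - 1)}`, hence `n σ ≡ j (1 - e σ)`
  have hnj : ∀ σ : absoluteGaloisGroup ℚ, n σ ≡ (j : ℤ) * (1 - e σ) [ZMOD 3] := by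
    intro σ
    have h1 : (cc σ : AlgebraicClosure ℚ) = σ • (α : AlgebraicClosure ℚ) / α := by
      rw [hcα σ, Units.val_div_eq_div_val, Units.coe_smul]
    have hσr : σ • ((r : ℚ) : AlgebraicClosure ℚ) = r := by
      rw [absoluteGaloisGroup.smul_def, map_ratCast]
    have hσζ' : σ • ζ = ζ ^ (((χ σ : (ZMod 3)ˣ) : ZMod 3).val) :=
      modNCyclotomicCharacter_spec ℚ 3 σ ζ hζ.pow_eq_one
    rw [hccval, hαr, smul_mul', hσr, smul_pow', hσζ', mul_div_mul_left _ _ hr0, ← pow_mul, ← zpow_natCast,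
      ← zpow_natCast, ← zpow_sub₀ hζ0] at h1
    -- `h1 : ζ ^ (e σ * n σ) = ζ ^ (↑(val * j) - ↑j)`
    have h2 : (ζ : AlgebraicClosure ℚ) ^
        (e σ * n σ - (((((χ σ : (ZMod 3)ˣ) : ZMod 3).val * j : ℕ) : ℤ) - j)) = 1 := by
      rw [zpow_sub₀ hζ0, h1, div_self (zpow_ne_zero _ hζ0)]
    have h3 := (hζ.zpow_eq_one_iff_dvd _).mp h2
    have h4 : e σ * n σ ≡ e σ * j - j [ZMOD 3] := by
      refine (Int.modEq_iff_dvd.mpr ?_).symm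
      simp only [he] at h3 ⊢
      push_cast at h3 ⊢
      exact h3
    -- multiply by `e σ` and use `e σ² ≡ 1`
    calc n σ = 1 * n σ := (one_mul _).symm
      _ ≡ (e σ * e σ) * n σ [ZMOD 3] := (hesq σ).symm.mul_right _
      _ = e σ * (e σ * n σ) := by ring
      _ ≡ e σ * (e σ * j - j) [ZMOD 3] := h4.mul_left _
      _ = (e σ * e σ) * j - e σ * j := by ring
      _ ≡ 1 * j - e σ * j [ZMOD 3] := ((hesq σ).mul_right _).sub_right _
      _ = (j : ℤ) * (1 - e σ) := by ring
  -- ### the complement: `b₁ = b₀ - j a₀`, `B = L + ℤ b₁`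
  set b₁ : V := b₀ - (j : ℤ) • a₀ with hb₁
  have hb₁M : b₁ ∈ M := M.sub_mem hb₀M (M.zsmul_mem ha₀M _)
  have h3b₁ : (3 : ℤ) • b₁ ∈ L := by
    rw [hb₁, smul_sub, smul_smul, mul_comm, mul_smul]
    exact L.sub_mem h3b₀ (L.zsmul_mem h3a₀ _)
  -- `σ b₁ ≡ e σ b₁ (mod L)`
  have hb₁σ : ∀ σ : absoluteGaloisGroup ℚ, σ • b₁ - e σ • b₁ ∈ L := by
    intro σ
    obtain ⟨y, hy, hσ⟩ := hdecomp σ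
    obtain ⟨y₂, hy₂, hσa⟩ := hA' σ
    have : σ • b₁ - e σ • b₁ = (n σ - (j : ℤ) * (1 - e σ)) • a₀ + (y - (j : ℤ) • y₂) := by
      rw [hb₁, smul_sub, hσz, hσ, hσa, smul_sub]
      module
    rw [this]
    exact L.add_mem (hLmul h3a₀ (hnj σ).symm.dvd) (L.sub_mem hy (L.zsmul_mem hy₂ _))
  -- ### the complement `B = L + ℤ b₁`
  refine ⟨L ⊔ AddSubgroup.zmultiples b₁, le_sup_left,
    sup_le (hLN.trans hNM) (AddSubgroup.zmultiples_le.mpr hb₁M), ?_, ?_, ?_⟩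
  · -- `B ⊓ N = L`
    refine le_antisymm ?_ (le_inf le_sup_left hLN)
    rintro x ⟨hxB, hxN⟩
    obtain ⟨y, hy, z, hz, rfl⟩ := AddSubgroup.mem_sup.mp hxB
    obtain ⟨k, rfl⟩ := AddSubgroup.mem_zmultiples_iff.mp hz
    have hkN : k • b₁ ∈ N := by
      have : k • b₁ = (y + k • b₁) - y := by abel
      rw [this]
      exact N.sub_mem hxN (hLN hy)
    have hkb₀ : k • b₀ ∈ N := by
      have : k • b₀ = k • b₁ + (k * (j : ℤ)) • a₀ := by rw [hb₁, smul_sub, mul_smul]; abel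
      rw [this]
      exact N.add_mem hkN (N.zsmul_mem ha₀N _)
    have hk : (3 : ℤ) ∣ k := three_dvd_of_zsmul_mem (hLN h3b₀) hb₀N hkb₀
    exact L.add_mem hy (hLmul h3b₁ hk)
  · -- `N ⊔ B = M`
    refine le_antisymm (sup_le hNM (sup_le (hLN.trans hNM) (AddSubgroup.zmultiples_le.mpr hb₁M))) ?_
    intro x hx
    obtain ⟨j', hj'⟩ := genM x hx
    have hxN : x - j' • b₁ ∈ N := by
      have : x - j' • b₁ = (x - j' • b₀) + (j' * (j : ℤ)) • a₀ := by rw [hb₁, smul_sub, mul_smul]; abel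
      rw [this]
      exact N.add_mem hj' (N.zsmul_mem ha₀N _)
    exact AddSubgroup.mem_sup.mpr ⟨x - j' • b₁, hxN, j' • b₁,
      AddSubgroup.mem_sup_right (AddSubgroup.mem_zmultiples_iff.mpr ⟨j', rfl⟩), by abel⟩
  · -- `Γ_ℚ`-stability
    intro σ x hx
    obtain ⟨y, hy, z, hz, rfl⟩ := AddSubgroup.mem_sup.mp hx
    obtain ⟨k, rfl⟩ := AddSubgroup.mem_zmultiples_iff.mp hz
    have key : σ • (y + k • b₁) = σ • y + k • (σ • b₁) := by rw [smul_add, hσz]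
    have : σ • y + k • (σ • b₁) = (σ • y + k • (σ • b₁ - e σ • b₁)) + (k * e σ) • b₁ := by
      generalize σ • y = u
      generalize σ • b₁ = w
      module
    rw [key, this]
    exact AddSubgroup.mem_sup.mpr ⟨σ • y + k • (σ • b₁ - e σ • b₁),
      L.add_mem (hL σ y hy) (L.zsmul_mem (hb₁σ σ) _), (k * e σ) • b₁,
      AddSubgroup.mem_zmultiples_iff.mpr ⟨k * e σ, rfl⟩, rfl⟩

end Summit.BirchSwinnertonDyer.BirchSwinnertonDyer.Theorems.FullDescentKummerSplitting

end
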